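import Mathlib
import Literature.NumberTheory.LFunctions.Zhang2022.Section8aStatements
import Literature.NumberTheory.LFunctions.Zhang2022.Section5Lemma51
import Literature.NumberTheory.LFunctions.Zhang2022.Section5Lemma52Holds
import Literature.NumberTheory.LFunctions.Zhang2022.Section5Lemma59Ded
import Literature.NumberTheory.LFunctions.Zhang2022.Section6LFunctionStripGrowth
import Literature.NumberTheory.LFunctions.Zhang2022.Section8Ded81Prelims
import HarnessLib

/-!
# Zhang (2022) §8, (8.1) second equality (`Z22:(8.1)`b): `∂ℜ` versus `𝔍(±α)` — discharged modulo Prop. 2.2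

Topic `Literature/NumberTheory/LFunctions/Zhang2022` (Landau–Siegel audit tree; verdict-neutral).
Y. Zhang, *Discrete mean estimates and the Landau–Siegel zero*, arXiv:2211.02515v1 (2022)
[Zhang2022LandauSiegel] — an unrefereed manuscript under adjudication; nothing here asserts or denies
its Theorems 1–2. Campaign D-0069, cone C19 (Lemma 8.1), node `Z22:(8.1)` second equality, typed as
`Section8aStatements.Eq81b c′` (p. 42, tex L2203–2205):

> "By Lemma 5.9, the residue theorem and a simple bound for `ω(s)`,
> `Σ_ρ 𝒞*AAω(ρ) = (1/2πi)∫_ℜ 𝒞̃(s,ψ)A(𝐚₁;s,ψ)A(𝐚₂,1−s,ψ̄)ω(s) ds = Ĩ₁⁺(𝐚₁,𝐚₂;ψ) − Ĩ₁⁻(𝐚₁,𝐚₂;ψ) + O(ε)`."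

PROVED here: `eq81b_of_prop22 : 0 ≤ c′ → Skeleton.Prop22 c′ → Eq81b c′` (and the board-announced
shape `eq81b_of`, whose Lemma 5.2 / 5.9 arguments are subsumed), with `ε = e^{−𝓛¹⁰/8}` (`c = 1/8`) and
an implied constant depending only on `B` (the (7.2) bound), the Lemma 5.2 and Lemma 5.9 constants and
`ζ(5/4)`. The printed half-sentence, made explicit:

* `rectIntegral_sub_segInt_eq` — the contour bookkeeping: `(1/2πi)∫_{∂ℜ} − (Ĩ₁⁺ − Ĩ₁⁻)` is
  `(1/2πi)(bottom − top)` plus `(1/2π)` times four vertical slivers between the admissible heights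
  `2πt₀ + 𝓛₁^{±}` and `2πt₀ ± 𝓛₁` (interval additivity; needs continuity along `σ = ½ ± α`);
* `norm_omegaW_le_exp` — "a simple bound for `ω(s)`": `|ω(σ+it)| ≤ e^{2−𝓛¹⁰/4}` once
  `|t − 2πt₀| ≥ 𝓛₁ − 1`, `|σ − ½| ≤ 1` (`|ω| = (√π/𝓛₂)e^{((σ−½)²−(t−2πt₀)²)/(4𝓛₂²)}`, `𝓛₁² = 𝓛₂²𝓛¹⁰`);
* `norm_integrandTilde_le` — on those pieces `|𝒞̃AAω| ≤ K e^{−𝓛¹⁰/8}`: `𝒞̃ = −i[Y₁Y₂Y₃/Y][L(s+β₁)/L(s)]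
  L(s+β₂)L(s+β₃)` (`calCt_eq_prod`), with `|Y₁Y₂Y₃/Y| ≤ (|C₅₂|+1)e¹⁴` by Lemma 5.2 (tree theorem
  `Skeleton.lemma52_holds`) and `|Z(s,ψ)|⁻¹ ≤ e¹⁴` (`norm_inv_Zfac_le_exp14`, the lower companion of the
  tree's `GammaFactor.norm_Zfac_le_exp_of_abs_sub_half_le`), `|L(s+β₁)/L(s)| ≤ C₅₉ log P` by Lemma 5.9 on
  `|t − 2πt₀| ≤ 𝓛₁ + ¼` (tree theorem `Skeleton.lemma59_restricted_of_prop22`, i.e. from Prop. 2.2),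
  `|L(s+β_{2,3},ψ)| ≤ 4p³ζ(5/4)(9𝓛⁵¹⁹)³` (tree `StripGrowth.norm_LFunction_le_of_abs_re_le`),
  `|A| ≤ (P+1)B`, and the bookkeeping `𝓛⁹p⁶(9𝓛⁵¹⁹)⁶(P+1)²e^{2−𝓛¹⁰/4} ≤ 9⁶·256·e²·e^{−𝓛¹⁰/8}` for
  `𝓛 ≥ 80`;
* `clearance_of_prop22i`, `continuousOn_integrandTilde_vertical` — the clearance `|s − ρ| ≥ α` on
  `σ = ½ ± α` (Prop. 2.2 (i): zeros in `Ω` are on the line) gives both Lemma 5.9's hypothesis on the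
  slivers and `M(s,ψ) ≠ 0` there, hence continuity; on `∂ℜ` the clearance is the admissibility
  (`AdmRect`) of the typed node.

Theorems only: no new definitions, no new facts; axioms standard. The node's announced inputs
(Prop. 2.2, Lemmas 5.2, 5.9) all enter as consequences of `Skeleton.Prop22 c′` and tree theorems, so
the discharge is an edge from the cone's leaf `Prop22` exactly as for the first equality
(`Section8Eq81aResidue.eq81a_of_prop22`). WHAT THIS IS NOT: any claim about Proposition 2.2, Lemma 8.1's
truth, Theorems 1–2 of the source, or Landau–Siegel zeros.

## References

* Y. Zhang, arXiv:2211.02515v1 (2022), §8 (8.1) p. 42, tex L2197–2210; §2 (2.13), (2.15); §5 Lemmas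
  5.2, 5.9; §7 (7.2). [cite: Zhang2022LandauSiegel, §8 (8.1) p.42]
-/

noncomputable section

open Complex Real MeasureTheory Set intervalIntegral

namespace Literature.NumberTheory.LFunctions.Zhang2022.Section8aStatements

open Skeleton

/-! ### A. The parameters for large `D` -/

/-- Sizes of `α`, `Cα` and the shifts `b_j` once `𝓛 ≥ 80`, `𝓛 ≥ 5π|c′| + 1`, `𝓛 ≥ 4π|C| + 1`.
[cite: Zhang2022LandauSiegel, §2 (2.10), (2.13)] -/
private theorem params81 {c' C : ℝ} {D : ℕ} (h80 : 80 ≤ ell D) (hc : 5 * π * |c'| + 1 ≤ ell D)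
    (hC : 4 * π * |C| + 1 ≤ ell D) :
    0 < alpha D ∧ alpha D = π / ell D ^ 9 ∧ alpha D ≤ 1 / 100 ∧ |C| * alpha D ≤ 1 / 4 ∧
      |b1 c' D| ≤ 4 * alpha D ∧ |b2 c' D| ≤ 4 * alpha D ∧ |b3 c' D| ≤ 4 * alpha D := by
  have hπ := Real.pi_pos
  have hL0 : 0 < ell D := by linarith
  have hL1 : 1 ≤ ell D := by linarith
  have hα : alpha D = π / ell D ^ 9 := by rw [alpha, bigP, Real.log_exp]
  have hL9 : ell D ≤ ell D ^ 9 := by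
    calc ell D = ell D ^ 1 := (pow_one _).symm
      _ ≤ ell D ^ 9 := pow_le_pow_right₀ hL1 (by norm_num)
  have hL8 : ell D ≤ ell D ^ 8 := by
    calc ell D = ell D ^ 1 := (pow_one _).symm
      _ ≤ ell D ^ 8 := pow_le_pow_right₀ hL1 (by norm_num)
  have hL9pos : 0 < ell D ^ 9 := by positivity
  have hL8pos : 0 < ell D ^ 8 := by positivity
  have hα0 : 0 < alpha D := by rw [hα]; positivity
  have hαL : alpha D ≤ π / ell D := by
    rw [hα]; exact div_le_div_of_nonneg_left hπ.le hL0 hL9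
  have hα100 : alpha D ≤ 1 / 100 := by
    have hL2 : ell D ^ 2 ≤ ell D ^ 9 := pow_le_pow_right₀ hL1 (by norm_num)
    rw [hα, div_le_iff₀ hL9pos]; nlinarith [Real.pi_lt_four]
  have hCα : |C| * alpha D ≤ 1 / 4 := by
    have h1 : |C| * alpha D ≤ |C| * (π / ell D) := mul_le_mul_of_nonneg_left hαL (abs_nonneg C)
    have h2 : |C| * (π / ell D) ≤ 1 / 4 := by
      rw [← mul_div_assoc, div_le_iff₀ hL0]; nlinarith [abs_nonneg C]
    exact h1.trans h2
  -- `|c′| α 𝓛 ≤ 1/5`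
  have hαℓ : alpha D * ell D = π / ell D ^ 8 := by
    rw [hα]; field_simp
  have hcαL : |c'| * (alpha D * ell D) ≤ 1 / 5 := by
    rw [hαℓ]
    have h1 : |c'| * (π / ell D ^ 8) ≤ |c'| * (π / ell D) :=
      mul_le_mul_of_nonneg_left (div_le_div_of_nonneg_left hπ.le hL0 hL8) (abs_nonneg c')
    have h2 : |c'| * (π / ell D) ≤ 1 / 5 := by
      rw [← mul_div_assoc, div_le_iff₀ hL0]; nlinarith [abs_nonneg c']
    exact h1.trans h2
  have habs : |c' * alpha D * ell D| ≤ 1 / 5 := by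
    rw [mul_assoc, abs_mul, abs_of_nonneg (by positivity : 0 ≤ alpha D * ell D)]; exact hcαL
  obtain ⟨hm1, hm2⟩ := abs_le.mp habs
  refine ⟨hα0, hα, hα100, hCα, ?_, ?_, ?_⟩
  · rw [b1, abs_mul, abs_of_pos hα0]
    have : |1 - 5 * c' * alpha D * ell D| ≤ 4 := by
      rw [abs_le]; constructor <;> nlinarith
    nlinarith
  · rw [b2, abs_mul, abs_mul, abs_of_pos hα0, abs_two]
    have : |1 + c' * alpha D * ell D| ≤ 2 := by
      rw [abs_le]; constructor <;> nlinarith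
    nlinarith
  · rw [b3, abs_mul, abs_mul, abs_of_pos hα0, abs_of_pos (by norm_num : (0:ℝ) < 3)]
    have : |1 - c' * alpha D * ell D| ≤ 4 / 3 := by
      rw [abs_le]; constructor <;> nlinarith
    nlinarith

/-- The `t`-range of the contour pieces: `|t − 2π𝓛⁵¹⁹| ≤ 𝓛⁴⁰⁵ + 1/4`, `𝓛 ≥ 80` gives
`5𝓛⁵¹⁹ ≤ t ≤ 8𝓛⁵¹⁹`, `t ≥ 200`. [cite: Zhang2022LandauSiegel, §2 (2.8)] -/
private theorem trange81 {L t : ℝ} (hL : 80 ≤ L) (ht : |t - 2 * π * L ^ 519| ≤ L ^ 405 + 1 / 4) :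
    5 * L ^ 519 ≤ t ∧ t ≤ 8 * L ^ 519 ∧ 200 ≤ t := by
  have hL1 : 1 ≤ L := by linarith
  have h114 : 9 ≤ L ^ 114 := by
    have h : L ^ 1 ≤ L ^ 114 := pow_le_pow_right₀ hL1 (by norm_num)
    rw [pow_one] at h; linarith
  have h405 : L ^ 405 + 1 / 4 ≤ L ^ 519 := by
    have h1 : (1 : ℝ) ≤ L ^ 405 := one_le_pow₀ hL1
    calc L ^ 405 + 1 / 4 ≤ L ^ 405 * 9 := by nlinarith
      _ ≤ L ^ 405 * L ^ 114 := by gcongr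
      _ = L ^ 519 := by rw [← pow_add]
  have h519 : L ≤ L ^ 519 := by
    calc L = L ^ 1 := (pow_one _).symm
      _ ≤ L ^ 519 := pow_le_pow_right₀ hL1 (by norm_num)
  obtain ⟨ht1, ht2⟩ := abs_le.mp ht
  have hπa : 3 * L ^ 519 ≤ π * L ^ 519 :=
    mul_le_mul_of_nonneg_right Real.pi_gt_three.le (by positivity)
  have hπb : π * L ^ 519 ≤ 3.15 * L ^ 519 :=
    mul_le_mul_of_nonneg_right Real.pi_lt_d2.le (by positivity)
  exact ⟨by linarith, by linarith, by linarith⟩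

/-- The threshold `D ≥ ⌈e^{L₀}⌉` gives `L₀ ≤ 𝓛`. [folklore] -/
private theorem eq81b_threshold_le_ell {L₀ : ℝ} {D : ℕ} (hD : ⌈Real.exp L₀⌉₊ ≤ D) : L₀ ≤ ell D := by
  have h1 : Real.exp L₀ ≤ D := (Nat.le_ceil _).trans (by exact_mod_cast hD)
  have hD0 : (0 : ℝ) < D := (Real.exp_pos _).trans_le h1
  rw [ell, Real.le_log_iff_exp_le hD0]; exact h1

/-! ### B. `|Z(s,ψ)|⁻¹ ≤ e¹⁴` near the critical line -/

/-- **Lower companion of (4.5)/Lemma 5.1's mechanism**: for a primitive `θ (mod k)`,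
`|σ − 1/2| ≤ 1/4`, `t ≥ 4`: `|Z(σ+it,θ)| ≥ exp(−|σ−½|(|log(kt/2π)| + 14/t))` (integrate the
logarithmic derivative from `½ + it`, where `|Z| = 1`). [cite: Zhang2022LandauSiegel, §4 (4.5); §5 Lemma 5.1] -/
theorem exp_neg_le_norm_Zfac {k : ℕ} [NeZero k] {θ : DirichletCharacter ℂ k} (hθ : θ.IsPrimitive)
    {σ t : ℝ} (hσ : |σ - 1 / 2| ≤ 1 / 4) (ht : 4 ≤ t) :
    Real.exp (-(|σ - 1 / 2| * (|Real.log ((k : ℝ) * t / (2 * π))| + 14 / t)))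
      ≤ ‖GammaFactor.Zfac θ ((σ : ℂ) + t * I)‖ := by
  have ht0 : 0 < t := by linarith
  set a : ℂ := (1 / 2 : ℂ) + t * I with ha
  set w : ℂ := ((σ - 1 / 2 : ℝ) : ℂ) with hw
  set L : ℝ := Real.log ((k : ℝ) * t / (2 * π)) with hL
  have hpt : ∀ x : ℝ, a + (x : ℂ) * w = ((1 / 2 + x * (σ - 1 / 2) : ℝ) : ℂ) + t * I := by
    intro x; rw [ha, hw]; push_cast; ring
  have hu : ∀ x ∈ Icc (0 : ℝ) 1,
      0 < 1 / 2 + x * (σ - 1 / 2) ∧ 1 / 2 + x * (σ - 1 / 2) ≤ 1 := by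
    intro x hx
    have h1 : |x * (σ - 1 / 2)| ≤ 1 / 4 := by
      rw [abs_mul, abs_of_nonneg hx.1]
      calc x * |σ - 1 / 2| ≤ 1 * (1 / 4) :=
            mul_le_mul hx.2 hσ (abs_nonneg _) zero_le_one
        _ = 1 / 4 := one_mul _
    obtain ⟨h1a, h1b⟩ := abs_le.mp h1
    constructor <;> linarith
  have him : ∀ x : ℝ, 0 < (a + (x : ℂ) * w).im := by
    intro x; rw [hpt]; simpa using ht0
  have hg : ∀ x ∈ Icc (0 : ℝ) 1, AnalyticAt ℂ (GammaFactor.Zfac θ) (a + x * w) :=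
    fun x _ => GammaFactor.analyticAt_Zfac θ (him x)
  have h0 : ∀ x ∈ Icc (0 : ℝ) 1, GammaFactor.Zfac θ (a + x * w) ≠ 0 :=
    fun x _ => GammaFactor.Zfac_ne_zero hθ (him x)
  have key := Lemma45.eq_mul_exp_integral_logDeriv_segment hg h0
  have haw : a + w = (σ : ℂ) + t * I := by rw [ha, hw]; push_cast; ring
  have ha1 : ‖GammaFactor.Zfac θ a‖ = 1 := GammaFactor.norm_Zfac_half_eq_one hθ ht0
  have hpw : ∀ x ∈ Set.uIoc (0 : ℝ) 1,
      ‖deriv (GammaFactor.Zfac θ) (a + x * w) / GammaFactor.Zfac θ (a + x * w)‖ ≤ |L| + 14 / t := by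
    intro x hx
    have hx' : x ∈ Icc (0 : ℝ) 1 := by
      rw [Set.uIoc_of_le zero_le_one] at hx; exact ⟨hx.1.le, hx.2⟩
    obtain ⟨hu0, hu1⟩ := hu x hx'
    have hlog := GammaFactor.norm_logDeriv_Zfac_add_log_le hθ (A := 1)
      (σ := 1 / 2 + x * (σ - 1 / 2)) (t := t) (y := 0) le_rfl hu0 hu1 (by linarith)
      (by rw [abs_zero]; linarith)
    have hpt' : ((1 / 2 + x * (σ - 1 / 2) : ℝ) : ℂ) + t * I + ((0 : ℝ) : ℂ) * I = a + x * w := by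
      rw [hpt]; push_cast; ring
    rw [hpt', logDeriv_apply] at hlog
    have h14 : (2 * |(0 : ℝ)| + 4 * 1 + 10) / t = 14 / t := by rw [abs_zero]; ring
    rw [h14] at hlog
    calc ‖deriv (GammaFactor.Zfac θ) (a + x * w) / GammaFactor.Zfac θ (a + x * w)‖
        = ‖(deriv (GammaFactor.Zfac θ) (a + x * w) / GammaFactor.Zfac θ (a + x * w) + (L : ℂ))
            - (L : ℂ)‖ := by rw [add_sub_cancel_right]
      _ ≤ ‖deriv (GammaFactor.Zfac θ) (a + x * w) / GammaFactor.Zfac θ (a + x * w) + (L : ℂ)‖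
            + ‖(L : ℂ)‖ := norm_sub_le _ _
      _ ≤ 14 / t + |L| := by
          rw [Complex.norm_real, Real.norm_eq_abs]
          exact add_le_add hlog le_rfl
      _ = |L| + 14 / t := add_comm _ _
  have hint := intervalIntegral.norm_integral_le_of_norm_le_const hpw
  rw [sub_zero, abs_one, mul_one] at hint
  rw [← haw, key, norm_mul, ha1, one_mul, Complex.norm_exp]
  refine Real.exp_le_exp.mpr ?_
  have hnw : ‖w * ∫ x in (0 : ℝ)..1, deriv (GammaFactor.Zfac θ) (a + x * w) /
      GammaFactor.Zfac θ (a + x * w)‖ ≤ |σ - 1 / 2| * (|L| + 14 / t) := by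
    rw [norm_mul, hw, Complex.norm_real, Real.norm_eq_abs]
    gcongr
  have hre := (abs_le.mp (Complex.abs_re_le_norm (w * ∫ x in (0 : ℝ)..1,
    deriv (GammaFactor.Zfac θ) (a + x * w) / GammaFactor.Zfac θ (a + x * w)))).1
  linarith

/-- The window `p ∼ P`: `P < p < P(1 + 𝓛⁻⁶⁸)`. [cite: Zhang2022LandauSiegel, §2 p.4] -/
private theorem p_window81 {D : ℕ} (x : Chr D) :
    bigP D < x.p ∧ (x.p : ℝ) < bigP D * (1 + (ell D ^ 68)⁻¹) := by
  have hm := x.mem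
  rw [primeWindow, Finset.mem_filter, Finset.mem_Ioo] at hm
  have hP : 0 ≤ bigP D := (Real.exp_pos _).le
  exact ⟨(Nat.floor_lt hP).mp hm.1.1, Nat.lt_ceil.mp hm.1.2⟩

/-- Bookkeeping behind `|Z|^{±1} ≤ e¹⁴` near `s₀`: for `𝓛 ≥ 3`, `|σ − ½| < 2α`, `|t − 2πt₀| < 𝓛₁ + 2`:
`|σ − ½| ≤ ¼`, `t ≥ 4` and `|σ − ½|(|log(pt/2π)| + 14/t) ≤ 14`. [cite: Zhang2022LandauSiegel, §4 (4.5)] -/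
private theorem shift_log_le_14 {D : ℕ} (hL : 3 ≤ ell D) (x : Chr D) {σ t : ℝ}
    (hσ : |σ - 1 / 2| < 2 * alpha D) (ht : |t - 2 * π * t0 D| < ell1 D + 2) :
    |σ - 1 / 2| ≤ 1 / 4 ∧ 4 ≤ t ∧
      |σ - 1 / 2| * (|Real.log ((x.p : ℝ) * t / (2 * π))| + 14 / t) ≤ 14 := by
  set L := ell D with hLdef
  have hL1 : 1 ≤ L := by linarith
  have hα : alpha D = π / L ^ 9 := by rw [alpha, bigP, Real.log_exp]
  have hL9 : (3 : ℝ) ^ 9 ≤ L ^ 9 := pow_le_pow_left₀ (by norm_num) hL 9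
  have hL9' : 0 < L ^ 9 := by positivity
  have h2α : 2 * alpha D ≤ 1 / 4 := by
    rw [hα, mul_div_assoc', div_le_iff₀ hL9']; nlinarith [Real.pi_lt_four]
  have hσ4 : |σ - 1 / 2| ≤ 1 / 4 := hσ.le.trans h2α
  rw [ell1, t0] at ht
  -- the `t`-range
  have h114 : 9 ≤ L ^ 114 := by
    have h : L ^ 2 ≤ L ^ 114 := pow_le_pow_right₀ hL1 (by norm_num)
    nlinarith
  have h405 : L ^ 405 + 2 ≤ L ^ 519 := by
    have h1 : (1 : ℝ) ≤ L ^ 405 := one_le_pow₀ hL1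
    calc L ^ 405 + 2 ≤ L ^ 405 * 9 := by nlinarith
      _ ≤ L ^ 405 * L ^ 114 := by gcongr
      _ = L ^ 519 := by rw [← pow_add]
  have h519 : (1 : ℝ) ≤ L ^ 519 := one_le_pow₀ hL1
  obtain ⟨ht1, ht2⟩ := abs_lt.mp ht
  have hπa : 3 * L ^ 519 ≤ π * L ^ 519 :=
    mul_le_mul_of_nonneg_right Real.pi_gt_three.le (by positivity)
  have hπb : π * L ^ 519 ≤ 3.15 * L ^ 519 :=
    mul_le_mul_of_nonneg_right Real.pi_lt_d2.le (by positivity)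
  have ht4 : 4 ≤ t := by linarith
  have ht8 : t ≤ 8 * L ^ 519 := by linarith
  have ht0 : 0 < t := by linarith
  obtain ⟨hPp, hpP⟩ := p_window81 x
  have hP0 : 0 < bigP D := Real.exp_pos _
  have hp0 : (0 : ℝ) < x.p := hP0.trans hPp
  have hp2 : (2 : ℝ) ≤ x.p := by exact_mod_cast x.prime.two_le
  have hq1 : 1 ≤ (x.p : ℝ) * t / (2 * π) := by
    rw [le_div_iff₀ (by positivity)]; nlinarith [Real.pi_lt_four]
  have hlogp : Real.log (x.p : ℝ) ≤ L ^ 9 + 1 := by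
    have h68 : (L ^ 68)⁻¹ ≤ 1 := inv_le_one_of_one_le₀ (one_le_pow₀ hL1)
    have h4 : (x.p : ℝ) ≤ bigP D * 2 :=
      hpP.le.trans (mul_le_mul_of_nonneg_left (by linarith) hP0.le)
    calc Real.log (x.p : ℝ) ≤ Real.log (bigP D * 2) := Real.log_le_log hp0 h4
      _ = L ^ 9 + Real.log 2 := by rw [Real.log_mul hP0.ne' two_ne_zero, bigP, Real.log_exp]
      _ ≤ L ^ 9 + 1 := by linarith [Real.log_two_lt_d9]
  have hlogt : Real.log t ≤ 3 + 519 * L := by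
    have h1 : Real.log t ≤ Real.log (8 * L ^ 519) := Real.log_le_log ht0 ht8
    rw [Real.log_mul (by norm_num) (by positivity), Real.log_pow] at h1
    have h8 : Real.log 8 ≤ 3 := by
      have : Real.log 8 = 3 * Real.log 2 := by
        rw [show (8 : ℝ) = 2 ^ 3 by norm_num, Real.log_pow]; norm_num
      rw [this]; linarith [Real.log_two_lt_d9]
    have hLL : Real.log L ≤ L := (Real.log_le_sub_one_of_pos (by linarith)).trans (by linarith)
    push_cast at h1
    nlinarith
  have hlog : |Real.log ((x.p : ℝ) * t / (2 * π))| ≤ 2 * L ^ 9 := by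
    rw [abs_of_nonneg (Real.log_nonneg hq1), Real.log_div (by positivity) (by positivity),
      Real.log_mul hp0.ne' ht0.ne']
    have h2π : 0 ≤ Real.log (2 * π) := Real.log_nonneg (by linarith [Real.pi_gt_three])
    have h9L : 519 * L + 4 ≤ L ^ 9 := by
      have h8 : (3 : ℝ) ^ 8 ≤ L ^ 8 := pow_le_pow_left₀ (by norm_num) hL 8
      have : L ^ 9 = L ^ 8 * L := by ring
      rw [this]; nlinarith
    linarith
  have h14 : 14 / t ≤ 4 := by rw [div_le_iff₀ ht0]; linarith
  refine ⟨hσ4, ht4, ?_⟩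
  calc |σ - 1 / 2| * (|Real.log ((x.p : ℝ) * t / (2 * π))| + 14 / t)
      ≤ (2 * (π / L ^ 9)) * (2 * L ^ 9 + 4) := by
        rw [← hα]
        exact mul_le_mul hσ.le (by linarith) (by positivity) (by linarith [abs_nonneg (σ - 1/2)])
    _ = 4 * π + 8 * π / L ^ 9 := by field_simp; ring
    _ ≤ 14 := by
        have : 8 * π / L ^ 9 ≤ 1 := by rw [div_le_iff₀ hL9']; nlinarith [Real.pi_lt_four]
        nlinarith [Real.pi_lt_d2]

/-- **`|Z(s,ψ)|⁻¹ ≤ e¹⁴`** for `ψ ∈ Ψ`, `|σ − ½| < 2α`, `|t − 2πt₀| < 𝓛₁ + 2`, `𝓛 ≥ 3` (the size of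
`Z(s,ψ)⁻¹` in Lemma 5.2's main term `(pt₀)^{β₃}Z(s,ψ)⁻¹`). [cite: Zhang2022LandauSiegel, §5 Lemma 5.2; §4 (4.5)] -/
theorem norm_inv_Zfac_le_exp14 {D : ℕ} (hL : 3 ≤ ell D) (x : Chr D) {σ t : ℝ}
    (hσ : |σ - 1 / 2| < 2 * alpha D) (ht : |t - 2 * π * t0 D| < ell1 D + 2) :
    ‖(GammaFactor.Zfac x.ψ ((σ : ℂ) + t * I))⁻¹‖ ≤ Real.exp 14 := by
  obtain ⟨hσ4, ht4, h14⟩ := shift_log_le_14 hL x hσ ht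
  have hlow := exp_neg_le_norm_Zfac x.prim hσ4 ht4
  rw [norm_inv]
  calc ‖GammaFactor.Zfac x.ψ ((σ : ℂ) + t * I)‖⁻¹
      ≤ (Real.exp (-(|σ - 1 / 2| * (|Real.log ((x.p : ℝ) * t / (2 * π))| + 14 / t))))⁻¹ :=
        inv_anti₀ (Real.exp_pos _) hlow
    _ = Real.exp (|σ - 1 / 2| * (|Real.log ((x.p : ℝ) * t / (2 * π))| + 14 / t)) := by
        rw [Real.exp_neg, inv_inv]
    _ ≤ Real.exp 14 := Real.exp_le_exp.mpr h14

/-! ### C. Trivial bounds: the Dirichlet polynomials and the weight -/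

/-- The trivial bound `|A(a;s,θ)| ≤ N·B` for `Re s ≥ 0`, `|a(n)| ≤ B` (modulus `k ≠ 1`, so the `n = 0`
term vanishes and `|n^{−s}| ≤ 1`). [cite: Zhang2022LandauSiegel, §7 (7.2)] -/
theorem norm_dirPoly_le_mul {k : ℕ} [NeZero k] (hk : k ≠ 1) (N : ℕ) {a : ℕ → ℂ} {B : ℝ}
    (ha : ∀ n, ‖a n‖ ≤ B) (θ : DirichletCharacter ℂ k) {s : ℂ} (hs : 0 ≤ s.re) :
    ‖Lemma81.dirPoly N a θ s‖ ≤ N * B := by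
  haveI : Nontrivial (ZMod k) := ZMod.nontrivial_iff.mpr hk
  rw [Lemma81.dirPoly_def]
  have hB : 0 ≤ B := (norm_nonneg _).trans (ha 0)
  calc ‖∑ n ∈ Finset.range N, a n * θ n * (n : ℂ) ^ (-s)‖
      ≤ ∑ n ∈ Finset.range N, ‖a n * θ n * (n : ℂ) ^ (-s)‖ := norm_sum_le _ _
    _ ≤ ∑ n ∈ Finset.range N, B := Finset.sum_le_sum fun n _ => ?_
    _ = N * B := by simp
  rcases Nat.eq_zero_or_pos n with rfl | hn
  · have h0 : θ ((0 : ℕ) : ZMod k) = 0 := by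
      rw [Nat.cast_zero]; exact MulChar.map_nonunit θ not_isUnit_zero
    rw [h0, mul_zero, zero_mul, norm_zero]; exact hB
  · rw [norm_mul, norm_mul]
    have h1 : ‖θ (n : ZMod k)‖ ≤ 1 := DirichletCharacter.norm_le_one θ _
    have h2 : ‖(n : ℂ) ^ (-s)‖ ≤ 1 := by
      rw [Complex.norm_natCast_cpow_of_pos hn]
      exact Real.rpow_le_one_of_one_le_of_nonpos (by exact_mod_cast hn) (by simpa using hs)
    calc ‖a n‖ * ‖θ (n : ZMod k)‖ * ‖(n : ℂ) ^ (-s)‖ ≤ B * 1 * 1 := by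
          gcongr; exact ha n
      _ = B := by ring

/-- "A simple bound for `ω(s)`" off the window: for `|σ − ½| ≤ 1`, `|t − 2πt₀| ≥ 𝓛₁ − 1`, `𝓛 ≥ 2`,
`|ω(s)| ≤ exp(2 − 𝓛¹⁰/4)` (`|ω(σ+it)| = (√π/𝓛₂)exp(((σ−½)² − (t−2πt₀)²)/(4𝓛₂²))`, `𝓛₁² = 𝓛₂²𝓛¹⁰`).
[cite: Zhang2022LandauSiegel, §8 (8.1); §2 (2.15)] -/
theorem norm_omegaW_le_exp {D : ℕ} (hL : 2 ≤ ell D) {s : ℂ} (hσ : |s.re - 1 / 2| ≤ 1)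
    (ht : ell1 D - 1 ≤ |s.im - 2 * π * t0 D|) :
    ‖omegaW D s‖ ≤ Real.exp (2 - ell D ^ 10 / 4) := by
  have hL1 : 1 ≤ ell D := by linarith
  have hℓ2 : 0 < ell2 D := by rw [ell2]; positivity
  rw [omegaW, SmoothWeight.norm_omega_eq hℓ2]
  have hsq : Real.sqrt π / ell2 D ≤ 1 := by
    rw [div_le_one hℓ2]
    have h4 : Real.sqrt π ≤ 2 := by
      rw [show (2 : ℝ) = Real.sqrt 4 by rw [show (4:ℝ) = 2 ^ 2 by norm_num, Real.sqrt_sq (by norm_num)]]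
      exact Real.sqrt_le_sqrt (by linarith [Real.pi_lt_four])
    have h2 : (2 : ℝ) ≤ ell2 D := by
      rw [ell2]
      calc (2 : ℝ) ≤ ell D := hL
        _ = ell D ^ 1 := (pow_one _).symm
        _ ≤ ell D ^ 400 := pow_le_pow_right₀ hL1 (by norm_num)
    linarith
  have hexp : ((s.re - 1 / 2) ^ 2 - (s.im - 2 * π * t0 D) ^ 2) / (4 * ell2 D ^ 2)
      ≤ 2 - ell D ^ 10 / 4 := by
    have h1 : (s.re - 1 / 2) ^ 2 ≤ 1 := by
      have := abs_le.mp hσ; nlinarith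
    have hℓ1 : (1 : ℝ) ≤ ell1 D := by rw [ell1]; exact one_le_pow₀ hL1
    have h2 : (ell1 D - 1) ^ 2 ≤ (s.im - 2 * π * t0 D) ^ 2 := by
      calc (ell1 D - 1) ^ 2 ≤ |s.im - 2 * π * t0 D| ^ 2 :=
            pow_le_pow_left₀ (by linarith) ht 2
        _ = (s.im - 2 * π * t0 D) ^ 2 := sq_abs _
    have h3 : ell1 D ^ 2 = ell2 D ^ 2 * ell D ^ 10 := by rw [ell1, ell2]; ring
    have h4 : ell1 D ≤ ell2 D ^ 2 := by
      rw [ell1, ell2, ← pow_mul]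
      exact pow_le_pow_right₀ hL1 (by norm_num)
    have hℓ2sq : 0 < 4 * ell2 D ^ 2 := by positivity
    rw [div_le_iff₀ hℓ2sq]
    nlinarith
  calc Real.sqrt π / ell2 D * Real.exp (((s.re - 1 / 2) ^ 2 - (s.im - 2 * π * t0 D) ^ 2) / (4 * ell2 D ^ 2))
      ≤ 1 * Real.exp (2 - ell D ^ 10 / 4) := by
        gcongr
    _ = Real.exp (2 - ell D ^ 10 / 4) := one_mul _

/-- `|A(𝐚;s,ψ)| ≤ (P+1)B` for `Re s ≥ 0` under (7.2) (`N = ⌈PT⁻²⌉ ≤ P + 1`).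
[cite: Zhang2022LandauSiegel, §7 (7.2)] -/
private theorem norm_Apoly_le_81b {D : ℕ} (x : Chr D) {B : ℝ} {a : ℕ → ℂ} (ha : Adm72 D B a) {s : ℂ}
    (hs : 0 ≤ s.re) : ‖Apoly x a s‖ ≤ (bigP D + 1) * B := by
  have hB : 0 ≤ B := (norm_nonneg _).trans (ha.1 0)
  have h := norm_dirPoly_le_mul x.p_ne_one (Nsupp D) ha.1 x.ψ hs
  rw [Apoly]
  refine h.trans (mul_le_mul_of_nonneg_right ?_ hB)
  have hP : 0 ≤ bigP D := (Real.exp_pos _).le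
  have hT : 1 ≤ bigT D ^ 2 :=
    one_le_pow₀ (by rw [bigT]; exact Real.one_le_exp (Real.rpow_nonneg (Real.log_natCast_nonneg D) _))
  have h1 : bigP D / bigT D ^ 2 ≤ bigP D := div_le_self hP hT
  have h2 : (Nsupp D : ℝ) < bigP D / bigT D ^ 2 + 1 := by
    rw [Nsupp]; exact Nat.ceil_lt_add_one (by positivity)
  linarith

/-- `|A(𝐚;1−s,ψ̄)| ≤ (P+1)B` for `Re s ≤ 1` under (7.2). [cite: Zhang2022LandauSiegel, §7 (7.2)] -/
private theorem norm_ApolyBar_le_81b {D : ℕ} (x : Chr D) {B : ℝ} {a : ℕ → ℂ} (ha : Adm72 D B a) {s : ℂ}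
    (hs : 0 ≤ s.re) : ‖ApolyBar x a s‖ ≤ (bigP D + 1) * B := by
  have hB : 0 ≤ B := (norm_nonneg _).trans (ha.1 0)
  have h := norm_dirPoly_le_mul x.p_ne_one (Nsupp D) ha.1 x.ψ⁻¹ hs
  rw [ApolyBar]
  refine h.trans (mul_le_mul_of_nonneg_right ?_ hB)
  have hP : 0 ≤ bigP D := (Real.exp_pos _).le
  have hT : 1 ≤ bigT D ^ 2 :=
    one_le_pow₀ (by rw [bigT]; exact Real.one_le_exp (Real.rpow_nonneg (Real.log_natCast_nonneg D) _))
  have h1 : bigP D / bigT D ^ 2 ≤ bigP D := div_le_self hP hT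
  have h2 : (Nsupp D : ℝ) < bigP D / bigT D ^ 2 + 1 := by
    rw [Nsupp]; exact Nat.ceil_lt_add_one (by positivity)
  linarith

/-- The convexity/Stirling size of `L(s + ib, ψ)` on the contour pieces: for `ψ ∈ Ψ`, `|b| ≤ 1`,
`|σ − ½| ≤ ¼`, `|t − 2πt₀| ≤ 𝓛₁ + ¼`, `𝓛 ≥ 80`: `|L(s+ib,ψ)| ≤ 4p³ζ(5/4)(9𝓛⁵¹⁹)³` (the tree's
`StripGrowth.norm_LFunction_le_of_abs_re_le` with `A = 1`). [cite: Zhang2022LandauSiegel, §8 p.43] -/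
private theorem norm_LFunction_shift_le_81b {D : ℕ} (h80 : 80 ≤ ell D) (x : Chr D) {s : ℂ} {b : ℝ}
    (hb : |b| ≤ 1) (hσ : |s.re - 1 / 2| ≤ 1 / 4) (ht : |s.im - 2 * π * t0 D| ≤ ell1 D + 1 / 4) :
    ‖x.ψ.LFunction (s + (b : ℂ) * I)‖ ≤
      4 * (x.p : ℝ) ^ 3 * (∑' n : ℕ, ((n + 1 : ℕ) : ℝ) ^ (-(5 / 4 : ℝ))) * (9 * ell D ^ 519) ^ 3 := by
  have hre : (s + (b : ℂ) * I).re = s.re := by simp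
  have him : (s + (b : ℂ) * I).im = s.im + b := by simp
  rw [ell1, t0] at ht
  obtain ⟨ht5, ht8, ht200⟩ := trange81 h80 ht
  have hL1 : 1 ≤ ell D := by linarith
  have h519 : ell D ≤ ell D ^ 519 := by
    calc ell D = ell D ^ 1 := (pow_one _).symm
      _ ≤ ell D ^ 519 := pow_le_pow_right₀ hL1 (by norm_num)
  obtain ⟨hb1, hb2⟩ := abs_le.mp hb
  obtain ⟨hs1, hs2⟩ := abs_le.mp hσ
  have hσ1 : |(s + (b : ℂ) * I).re| ≤ ((1 : ℕ) : ℝ) := by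
    rw [hre, Nat.cast_one, abs_le]; constructor <;> linarith
  have him152 : 38 * (((1 : ℕ) : ℝ) + 1) ^ 2 ≤ |(s + (b : ℂ) * I).im| := by
    rw [him, Nat.cast_one, abs_of_pos (by linarith)]; norm_num; linarith
  have h := StripGrowth.norm_LFunction_le_of_abs_re_le x.prim x.p_ne_one (A := 1) le_rfl hσ1 him152
  have him9 : |(s + (b : ℂ) * I).im| + ((1 : ℕ) : ℝ) + 1 ≤ 9 * ell D ^ 519 := by
    rw [him, Nat.cast_one, abs_of_pos (by linarith)]; linarith
  have hZ : 0 ≤ ∑' n : ℕ, ((n + 1 : ℕ) : ℝ) ^ (-(5 / 4 : ℝ)) := tsum_nonneg fun n => by positivity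
  have hi0 : 0 ≤ |(s + (b : ℂ) * I).im| + ((1 : ℕ) : ℝ) + 1 := by positivity
  calc ‖x.ψ.LFunction (s + (b : ℂ) * I)‖
      ≤ 4 * (x.p : ℝ) ^ (1 + 2) * (∑' n : ℕ, ((n + 1 : ℕ) : ℝ) ^ (-(5 / 4 : ℝ))) *
          (|(s + (b : ℂ) * I).im| + ((1 : ℕ) : ℝ) + 1) ^ (1 + 2) := h
    _ ≤ 4 * (x.p : ℝ) ^ 3 * (∑' n : ℕ, ((n + 1 : ℕ) : ℝ) ^ (-(5 / 4 : ℝ))) * (9 * ell D ^ 519) ^ 3 := by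
        rw [show (1 : ℕ) + 2 = 3 from rfl]
        gcongr

/-- The factorisation `𝒞̃(s,ψ) = −i·[Y₁Y₂Y₃/Y]·[L(s+β₁)/L(s)]·L(s+β₂)L(s+β₃)` (`M = YL`).
[cite: Zhang2022LandauSiegel, §8 p.42, tex L2194] -/
theorem calCt_eq_prod (c' : ℝ) {D : ℕ} (x : Chr D) (s : ℂ) :
    calCt c' x s =
      -I * (Yroot x.ψ (s + beta1 c' D) * Yroot x.ψ (s + beta2 c' D) * Yroot x.ψ (s + beta3 c' D) /
          Yroot x.ψ s) *
        (x.ψ.LFunction (s + beta1 c' D) / x.ψ.LFunction s) *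
        x.ψ.LFunction (s + beta2 c' D) * x.ψ.LFunction (s + beta3 c' D) := by
  simp only [calCt, Mfun, div_eq_mul_inv, mul_inv]
  ring

/-- The size bookkeeping of the contour pieces: for `𝓛 ≥ 80`, `0 ≤ p ≤ 2P`, `P = e^{𝓛⁹}`,
`𝓛⁹·p⁶·(9𝓛⁵¹⁹)⁶·(P+1)²·e^{2−𝓛¹⁰/4} ≤ 9⁶·256·e²·e^{−𝓛¹⁰/8}`. [folklore] -/
private theorem envelope81 {L p P : ℝ} (hL : 80 ≤ L) (hP : P = Real.exp (L ^ 9)) (hp0 : 0 ≤ p)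
    (hp : p ≤ 2 * P) :
    L ^ 9 * p ^ 6 * (9 * L ^ 519) ^ 6 * (P + 1) ^ 2 * Real.exp (2 - L ^ 10 / 4)
      ≤ 9 ^ 6 * 256 * Real.exp 2 * Real.exp (-(L ^ 10 / 8)) := by
  have hL0 : 0 < L := by linarith
  have hL1 : 1 ≤ L := by linarith
  have hP1 : 1 ≤ P := by rw [hP]; exact Real.one_le_exp (by positivity)
  have hP0 : 0 ≤ P := by linarith
  -- `p⁶ ≤ 64 e^{6𝓛⁹}`, `(P+1)² ≤ 4e^{2𝓛⁹}`
  have h1 : p ^ 6 ≤ 64 * Real.exp (6 * L ^ 9) := by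
    calc p ^ 6 ≤ (2 * P) ^ 6 := pow_le_pow_left₀ hp0 hp 6
      _ = 64 * Real.exp (6 * L ^ 9) := by
          rw [mul_pow, hP, ← Real.exp_nat_mul]; norm_num
  have h2 : (P + 1) ^ 2 ≤ 4 * Real.exp (2 * L ^ 9) := by
    calc (P + 1) ^ 2 ≤ (2 * P) ^ 2 := pow_le_pow_left₀ (by linarith) (by linarith) 2
      _ = 4 * Real.exp (2 * L ^ 9) := by
          rw [mul_pow, hP, ← Real.exp_nat_mul]; norm_num
  -- `𝓛⁹(9𝓛⁵¹⁹)⁶ = 9⁶𝓛³¹²³ ≤ 9⁶e^{𝓛⁹}`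
  have h3 : L ^ 9 * (9 * L ^ 519) ^ 6 ≤ 9 ^ 6 * Real.exp (L ^ 9) := by
    have hLe : L ≤ Real.exp L := by linarith [Real.add_one_le_exp L]
    have h31 : L ^ 3123 ≤ Real.exp L ^ 3123 := pow_le_pow_left₀ hL0.le hLe 3123
    rw [← Real.exp_nat_mul] at h31
    have h32 : Real.exp ((3123 : ℕ) * L) ≤ Real.exp (L ^ 9) := by
      refine Real.exp_le_exp.mpr ?_
      have h8 : (80 : ℝ) ^ 2 ≤ L ^ 2 := pow_le_pow_left₀ (by norm_num) hL 2
      have h8' : L ^ 2 ≤ L ^ 8 := pow_le_pow_right₀ hL1 (by norm_num)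
      have : L ^ 9 = L ^ 8 * L := by ring
      rw [this]; push_cast; nlinarith
    calc L ^ 9 * (9 * L ^ 519) ^ 6 = 9 ^ 6 * L ^ 3123 := by ring
      _ ≤ 9 ^ 6 * Real.exp (L ^ 9) := by
          exact mul_le_mul_of_nonneg_left (h31.trans h32) (by norm_num)
  -- exponent comparison
  have h4 : Real.exp (L ^ 9) * Real.exp (6 * L ^ 9) * Real.exp (2 * L ^ 9) * Real.exp (2 - L ^ 10 / 4)
      ≤ Real.exp 2 * Real.exp (-(L ^ 10 / 8)) := by
    rw [← Real.exp_add, ← Real.exp_add, ← Real.exp_add, ← Real.exp_add]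
    refine Real.exp_le_exp.mpr ?_
    have : L ^ 10 = L ^ 9 * L := by ring
    have h9 : 0 < L ^ 9 := by positivity
    nlinarith
  have hE0 : 0 ≤ Real.exp (2 - L ^ 10 / 4) := (Real.exp_pos _).le
  calc L ^ 9 * p ^ 6 * (9 * L ^ 519) ^ 6 * (P + 1) ^ 2 * Real.exp (2 - L ^ 10 / 4)
      = (L ^ 9 * (9 * L ^ 519) ^ 6) * p ^ 6 * (P + 1) ^ 2 * Real.exp (2 - L ^ 10 / 4) := by ring
    _ ≤ (9 ^ 6 * Real.exp (L ^ 9)) * (64 * Real.exp (6 * L ^ 9)) * (4 * Real.exp (2 * L ^ 9)) *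
          Real.exp (2 - L ^ 10 / 4) := by
        gcongr
    _ = 9 ^ 6 * 256 * (Real.exp (L ^ 9) * Real.exp (6 * L ^ 9) * Real.exp (2 * L ^ 9) *
          Real.exp (2 - L ^ 10 / 4)) := by ring
    _ ≤ 9 ^ 6 * 256 * (Real.exp 2 * Real.exp (-(L ^ 10 / 8))) :=
        mul_le_mul_of_nonneg_left h4 (by norm_num)
    _ = 9 ^ 6 * 256 * Real.exp 2 * Real.exp (-(L ^ 10 / 8)) := by ring

/-! ### D. The pointwise bound for the integrand of (8.1) on the contour pieces -/

/-- **"A simple bound for `ω(s)`" made effective**: on the pieces of `∂ℜ` off `𝔍(±α)` — `|σ − ½| ≤ α`,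
`𝓛₁ − 1 ≤ |t − 2πt₀| ≤ 𝓛₁ + ¼` — given the Lemma 5.2 comparison at `s` and the Lemma 5.9 bound at
`s`, the integrand `𝒞̃(s,ψ)A(𝐚₁;s,ψ)A(𝐚₂;1−s,ψ̄)ω(s)` of (8.1) is `≤ K·e^{−𝓛¹⁰/8}` with `K` free of
`D`, `ψ`, `s` (`|Y₁Y₂Y₃/Y| ≤ (|C₅₂|+1)e¹⁴`, `|L(s+β₁)/L(s)| ≤ (|C₅₉|+1)𝓛⁹`, `|L(s+β_{2,3})| ≤
4p³ζ(5/4)(9𝓛⁵¹⁹)³`, `|A| ≤ (P+1)B`, `|ω| ≤ e^{2−𝓛¹⁰/4}`). [cite: Zhang2022LandauSiegel, §8 (8.1) p.42, tex L2203–2205] -/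
theorem norm_integrandTilde_le (c' : ℝ) {D : ℕ} (x : Chr D) {B C₅₂ C₅₉ : ℝ} {a₁ a₂ : ℕ → ℂ}
    (h80 : 80 ≤ ell D) (hc : 5 * π * |c'| + 1 ≤ ell D)
    (ha₁ : Adm72 D B a₁) (ha₂ : Adm72 D B a₂) {s : ℂ}
    (hσ : |s.re - 1 / 2| ≤ alpha D)
    (ht1 : ell1 D - 1 ≤ |s.im - 2 * π * t0 D|) (ht2 : |s.im - 2 * π * t0 D| ≤ ell1 D + 1 / 4)
    (h52 : ‖Yroot x.ψ (s + beta1 c' D) * Yroot x.ψ (s + beta2 c' D) * Yroot x.ψ (s + beta3 c' D) /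
          Yroot x.ψ s - (((x.p : ℝ) * t0 D : ℝ) : ℂ) ^ beta3 c' D * (GammaFactor.Zfac x.ψ s)⁻¹‖
        ≤ C₅₂ * (ell D ^ 123)⁻¹ * ‖(((x.p : ℝ) * t0 D : ℝ) : ℂ) ^ beta3 c' D * (GammaFactor.Zfac x.ψ s)⁻¹‖)
    (h59 : ‖x.ψ.LFunction (s + beta1 c' D) / x.ψ.LFunction s‖ ≤ C₅₉ * Real.log (bigP D)) :
    ‖integrandTilde c' x a₁ a₂ s‖ ≤
      (|C₅₂| + 1) * Real.exp 14 * ((|C₅₉| + 1) *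
        (16 * (∑' n : ℕ, ((n + 1 : ℕ) : ℝ) ^ (-(5 / 4 : ℝ))) ^ 2) * B ^ 2 *
          (9 ^ 6 * 256 * Real.exp 2)) * Real.exp (-(ell D ^ 10 / 8)) := by
  have hL1 : 1 ≤ ell D := by linarith
  have hL3 : 3 ≤ ell D := by linarith
  obtain ⟨hα0, hα, hα100, -, hb1, hb2, hb3⟩ :=
    params81 (c' := c') (C := 0) h80 hc (by rw [abs_zero, mul_zero, zero_add]; exact hL1)
  set Zc : ℝ := ∑' n : ℕ, ((n + 1 : ℕ) : ℝ) ^ (-(5 / 4 : ℝ)) with hZc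
  have hZc0 : 0 ≤ Zc := tsum_nonneg fun n => by positivity
  have hB : 0 ≤ B := (norm_nonneg _).trans (ha₁.1 0)
  obtain ⟨hβ1, hβ2, hβ3⟩ := beta_eq_b_mul_I c' D
  have h4α : 4 * alpha D ≤ 1 := by linarith
  have hσ4 : |s.re - 1 / 2| ≤ 1 / 4 := hσ.trans (by linarith)
  obtain ⟨hs1, hs2⟩ := abs_le.mp hσ
  -- the five factor bounds
  have hmain : ‖(((x.p : ℝ) * t0 D : ℝ) : ℂ) ^ beta3 c' D * (GammaFactor.Zfac x.ψ s)⁻¹‖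
      ≤ Real.exp 14 := by
    rw [norm_mul]
    have hpt : 0 < (x.p : ℝ) * t0 D :=
      mul_pos (Nat.cast_pos.mpr x.prime.pos) (by rw [t0]; positivity)
    have h1 : ‖(((x.p : ℝ) * t0 D : ℝ) : ℂ) ^ beta3 c' D‖ = 1 := by
      rw [Complex.norm_cpow_eq_rpow_re_of_pos hpt]
      have : (beta3 c' D).re = 0 := by rw [hβ3]; simp
      rw [this, Real.rpow_zero]
    have h2 : ‖(GammaFactor.Zfac x.ψ s)⁻¹‖ ≤ Real.exp 14 := by
      have hs : s = ((s.re : ℝ) : ℂ) + (s.im : ℝ) * I := (Complex.re_add_im s).symm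
      rw [hs]
      exact norm_inv_Zfac_le_exp14 hL3 x (by linarith) (by linarith)
    rw [h1, one_mul]; exact h2
  have hY : ‖Yroot x.ψ (s + beta1 c' D) * Yroot x.ψ (s + beta2 c' D) * Yroot x.ψ (s + beta3 c' D) /
      Yroot x.ψ s‖ ≤ (|C₅₂| + 1) * Real.exp 14 := by
    set Yq := Yroot x.ψ (s + beta1 c' D) * Yroot x.ψ (s + beta2 c' D) * Yroot x.ψ (s + beta3 c' D) /
      Yroot x.ψ s
    set mn := (((x.p : ℝ) * t0 D : ℝ) : ℂ) ^ beta3 c' D * (GammaFactor.Zfac x.ψ s)⁻¹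
    have h123 : (ell D ^ 123)⁻¹ ≤ 1 := inv_le_one_of_one_le₀ (one_le_pow₀ hL1)
    have hi0 : 0 ≤ (ell D ^ 123)⁻¹ := by positivity
    have hcoef : C₅₂ * (ell D ^ 123)⁻¹ + 1 ≤ |C₅₂| + 1 := by
      have : C₅₂ * (ell D ^ 123)⁻¹ ≤ |C₅₂| * 1 :=
        (mul_le_mul_of_nonneg_right (le_abs_self _) hi0).trans
          (mul_le_mul_of_nonneg_left h123 (abs_nonneg _))
      linarith
    calc ‖Yq‖ = ‖(Yq - mn) + mn‖ := by rw [sub_add_cancel]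
      _ ≤ ‖Yq - mn‖ + ‖mn‖ := norm_add_le _ _
      _ ≤ C₅₂ * (ell D ^ 123)⁻¹ * ‖mn‖ + ‖mn‖ := by linarith [h52]
      _ = (C₅₂ * (ell D ^ 123)⁻¹ + 1) * ‖mn‖ := by ring
      _ ≤ (|C₅₂| + 1) * Real.exp 14 :=
          mul_le_mul hcoef hmain (norm_nonneg _) (by positivity)
  have hLq : ‖x.ψ.LFunction (s + beta1 c' D) / x.ψ.LFunction s‖ ≤ (|C₅₉| + 1) * ell D ^ 9 := by
    have hlogP : Real.log (bigP D) = ell D ^ 9 := by rw [bigP, Real.log_exp]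
    rw [hlogP] at h59
    exact h59.trans (mul_le_mul_of_nonneg_right (by linarith [le_abs_self C₅₉]) (by positivity))
  have hL2 : ‖x.ψ.LFunction (s + beta2 c' D)‖ ≤ 4 * (x.p : ℝ) ^ 3 * Zc * (9 * ell D ^ 519) ^ 3 := by
    rw [hβ2]; exact norm_LFunction_shift_le_81b h80 x (hb2.trans h4α) hσ4 ht2
  have hL3' : ‖x.ψ.LFunction (s + beta3 c' D)‖ ≤ 4 * (x.p : ℝ) ^ 3 * Zc * (9 * ell D ^ 519) ^ 3 := by
    rw [hβ3]; exact norm_LFunction_shift_le_81b h80 x (hb3.trans h4α) hσ4 ht2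
  have hA1 : ‖Apoly x a₁ s‖ ≤ (bigP D + 1) * B := norm_Apoly_le_81b x ha₁ (by linarith)
  have hA2 : ‖ApolyBar x a₂ (1 - s)‖ ≤ (bigP D + 1) * B :=
    norm_ApolyBar_le_81b x ha₂ (by simp only [sub_re, one_re]; linarith)
  have hω : ‖omegaW D s‖ ≤ Real.exp (2 - ell D ^ 10 / 4) :=
    norm_omegaW_le_exp (by linarith) (hσ.trans (by linarith)) ht1
  -- the window and the envelope
  obtain ⟨hPp, hpP⟩ := p_window81 x
  have hP0 : 0 < bigP D := Real.exp_pos _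
  have hp2P : (x.p : ℝ) ≤ 2 * bigP D := by
    have h68 : (ell D ^ 68)⁻¹ ≤ 1 := inv_le_one_of_one_le₀ (one_le_pow₀ hL1)
    nlinarith
  have henv := envelope81 (p := (x.p : ℝ)) h80 (rfl : bigP D = Real.exp (ell D ^ 9)) (Nat.cast_nonneg _) hp2P
  -- combine
  rw [integrandTilde, calCt_eq_prod]
  have hsplit : ‖-I * (Yroot x.ψ (s + beta1 c' D) * Yroot x.ψ (s + beta2 c' D) *
      Yroot x.ψ (s + beta3 c' D) / Yroot x.ψ s) *
      (x.ψ.LFunction (s + beta1 c' D) / x.ψ.LFunction s) * x.ψ.LFunction (s + beta2 c' D) *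
      x.ψ.LFunction (s + beta3 c' D) * Apoly x a₁ s * ApolyBar x a₂ (1 - s) * omegaW D s‖ =
      ‖Yroot x.ψ (s + beta1 c' D) * Yroot x.ψ (s + beta2 c' D) * Yroot x.ψ (s + beta3 c' D) /
          Yroot x.ψ s‖ *
        ‖x.ψ.LFunction (s + beta1 c' D) / x.ψ.LFunction s‖ * ‖x.ψ.LFunction (s + beta2 c' D)‖ *
        ‖x.ψ.LFunction (s + beta3 c' D)‖ * ‖Apoly x a₁ s‖ * ‖ApolyBar x a₂ (1 - s)‖ *
        ‖omegaW D s‖ := by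
    simp only [norm_mul, norm_neg, Complex.norm_I, one_mul]
  rw [hsplit]
  have hK0 : 0 ≤ (|C₅₂| + 1) * Real.exp 14 * ((|C₅₉| + 1) * (16 * Zc ^ 2) * B ^ 2) := by positivity
  calc ‖Yroot x.ψ (s + beta1 c' D) * Yroot x.ψ (s + beta2 c' D) * Yroot x.ψ (s + beta3 c' D) /
          Yroot x.ψ s‖ *
        ‖x.ψ.LFunction (s + beta1 c' D) / x.ψ.LFunction s‖ * ‖x.ψ.LFunction (s + beta2 c' D)‖ *
        ‖x.ψ.LFunction (s + beta3 c' D)‖ * ‖Apoly x a₁ s‖ * ‖ApolyBar x a₂ (1 - s)‖ *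
        ‖omegaW D s‖
      ≤ ((|C₅₂| + 1) * Real.exp 14) * ((|C₅₉| + 1) * ell D ^ 9) *
          (4 * (x.p : ℝ) ^ 3 * Zc * (9 * ell D ^ 519) ^ 3) *
          (4 * (x.p : ℝ) ^ 3 * Zc * (9 * ell D ^ 519) ^ 3) * ((bigP D + 1) * B) *
          ((bigP D + 1) * B) * Real.exp (2 - ell D ^ 10 / 4) := by
        gcongr
    _ = (|C₅₂| + 1) * Real.exp 14 * ((|C₅₉| + 1) * (16 * Zc ^ 2) * B ^ 2) *
          (ell D ^ 9 * (x.p : ℝ) ^ 6 * (9 * ell D ^ 519) ^ 6 * (bigP D + 1) ^ 2 *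
            Real.exp (2 - ell D ^ 10 / 4)) := by ring
    _ ≤ (|C₅₂| + 1) * Real.exp 14 * ((|C₅₉| + 1) * (16 * Zc ^ 2) * B ^ 2) *
          (9 ^ 6 * 256 * Real.exp 2 * Real.exp (-(ell D ^ 10 / 8))) :=
        mul_le_mul_of_nonneg_left henv hK0
    _ = (|C₅₂| + 1) * Real.exp 14 * ((|C₅₉| + 1) * (16 * Zc ^ 2) * B ^ 2 *
          (9 ^ 6 * 256 * Real.exp 2)) * Real.exp (-(ell D ^ 10 / 8)) := by ring

/-! ### E. Continuity of the integrand along the vertical lines `σ = ½ ± α` -/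

/-- Along a vertical line `σ + iy`, `y > 1`, on which `L(·,ψ)` has no zero, the integrand
`𝒞̃(s,ψ)A(𝐚₁;s,ψ)A(𝐚₂;1−s,ψ̄)ω(s)` of (8.1) is continuous in the height `y` (`Y` is analytic on
`Im s > 0`, `L`, `A`, `ω` are entire, `M(s,ψ) = Y(s)L(s) ≠ 0`). [cite: Zhang2022LandauSiegel, §8 (8.1) p.42] -/
theorem continuousOn_integrandTilde_vertical (c' : ℝ) {D : ℕ} (x : Chr D) (a₁ a₂ : ℕ → ℂ)
    (σ : ℝ) {S : Set ℝ} (hb1 : |b1 c' D| ≤ 1) (hb2 : |b2 c' D| ≤ 1) (hb3 : |b3 c' D| ≤ 1)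
    (hS : ∀ y ∈ S, 1 < y) (hL : ∀ y ∈ S, x.ψ.LFunction ((σ : ℂ) + y * I) ≠ 0) :
    ContinuousOn (fun y : ℝ => integrandTilde c' x a₁ a₂ ((σ : ℂ) + y * I)) S := by
  intro y hy
  apply ContinuousAt.continuousWithinAt
  have hy1 := hS y hy
  obtain ⟨hYd, hYsq⟩ := Yroot_spec x.prim
  obtain ⟨hβ1, hβ2, hβ3⟩ := beta_eq_b_mul_I c' D
  have hopen : IsOpen {z : ℂ | 0 < z.im} := isOpen_lt continuous_const Complex.continuous_im
  have hYc : ∀ z : ℂ, 0 < z.im → ContinuousAt (Yroot x.ψ) z := fun z hz =>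
    (hYd.differentiableAt (hopen.mem_nhds hz)).continuousAt
  have hLc : Continuous x.ψ.LFunction := Ded81Edge.continuous_LFunction_chr x
  have hM : ∀ β : ℂ, -1 ≤ β.im →
      ContinuousAt (fun y : ℝ => Mfun x.ψ ((σ : ℂ) + y * I + β)) y := by
    intro β hβ
    have h1 : ContinuousAt (fun y : ℝ => (σ : ℂ) + y * I + β) y := by fun_prop
    have hz : 0 < ((σ : ℂ) + y * I + β).im := by simp; linarith
    have hY1 : ContinuousAt (fun y : ℝ => Yroot x.ψ ((σ : ℂ) + y * I + β)) y :=
      (hYc _ hz).comp_of_eq h1 rfl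
    have hL1 : ContinuousAt (fun y : ℝ => x.ψ.LFunction ((σ : ℂ) + y * I + β)) y :=
      hLc.continuousAt.comp_of_eq h1 rfl
    have h := hY1.mul hL1
    simpa only [Mfun, Pi.mul_def] using h
  have hM0 : ContinuousAt (fun y : ℝ => Mfun x.ψ ((σ : ℂ) + y * I)) y := by
    have h := hM 0 (by simp)
    simpa using h
  have hne : Mfun x.ψ ((σ : ℂ) + y * I) ≠ 0 := by
    have hz : 0 < ((σ : ℂ) + (y : ℂ) * I).im := by simp; linarith
    have hY0 : Yroot x.ψ ((σ : ℂ) + y * I) ≠ 0 := by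
      intro h0
      have h2 := hYsq _ hz
      rw [h0, zero_pow two_ne_zero] at h2
      exact (inv_ne_zero (GammaFactor.Zfac_ne_zero x.prim hz)) h2.symm
    exact mul_ne_zero hY0 (hL y hy)
  have hb1' : -1 ≤ (beta1 c' D).im := by
    rw [hβ1]; simp only [mul_im, ofReal_re, I_im, ofReal_im, I_re]; linarith [abs_le.mp hb1]
  have hb2' : -1 ≤ (beta2 c' D).im := by
    rw [hβ2]; simp only [mul_im, ofReal_re, I_im, ofReal_im, I_re]; linarith [abs_le.mp hb2]
  have hb3' : -1 ≤ (beta3 c' D).im := by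
    rw [hβ3]; simp only [mul_im, ofReal_re, I_im, ofReal_im, I_re]; linarith [abs_le.mp hb3]
  have hC : ContinuousAt (fun y : ℝ => calCt c' x ((σ : ℂ) + y * I)) y := by
    have h := ((continuousAt_const (y := -I)).mul
      (((hM _ hb1').mul (hM _ hb2')).mul (hM _ hb3'))).div hM0 hne
    simpa only [calCt, Pi.mul_def, Pi.div_def] using h
  have hline : Continuous fun y : ℝ => (σ : ℂ) + y * I := by fun_prop
  have hA1 : Continuous fun y : ℝ => Apoly x a₁ ((σ : ℂ) + y * I) :=
    (Ded81Edge.continuous_dirPoly (Nsupp D) a₁ x.ψ x.p_ne_one).comp hline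
  have hA2 : Continuous fun y : ℝ => ApolyBar x a₂ (1 - ((σ : ℂ) + y * I)) :=
    (Ded81Edge.continuous_dirPoly (Nsupp D) a₂ x.ψ⁻¹ x.p_ne_one).comp
      (continuous_const.sub hline)
  have hω : Continuous fun y : ℝ => omegaW D ((σ : ℂ) + y * I) :=
    (Ded81Edge.continuous_omega (ell2 D) (t0 D)).comp hline
  have h := ((hC.mul hA1.continuousAt).mul hA2.continuousAt).mul hω.continuousAt
  simpa only [integrandTilde, Pi.mul_def] using h

/-! ### F. The contour bookkeeping: `∂ℜ` versus `𝔍(α) − 𝔍(−α)` -/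

/-- **The contour of (8.1) against `𝔍(±α)`**: for any `F` continuous along the two vertical lines
`σ = ½ ± α` on a height range containing `2πt₀ + 𝓛₁^{±}` and `2πt₀ ± 𝓛₁`,
`(1/2πi)∫_{∂ℜ}F − ((1/2πi)∫_{𝔍(α)}F − (1/2πi)∫_{𝔍(−α)}F)` is `(1/2πi)(bottom − top)` plus `(1/2π)`
times the four vertical slivers between `2πt₀ + 𝓛₁^{±}` and `2πt₀ ± 𝓛₁`.
[cite: Zhang2022LandauSiegel, §8 (8.1) p.42, tex L2203–2205] -/
theorem rectIntegral_sub_segInt_eq {D : ℕ} (F : ℂ → ℂ) (Lm Lp lo hi : ℝ)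
    (hKb : ContinuousOn (fun y : ℝ => F (((1 / 2 + alpha D : ℝ) : ℂ) + y * I)) (Icc lo hi))
    (hKa : ContinuousOn (fun y : ℝ => F (((1 / 2 - alpha D : ℝ) : ℂ) + y * I)) (Icc lo hi))
    (hc : 2 * π * t0 D + Lm ∈ Icc lo hi) (hd : 2 * π * t0 D + Lp ∈ Icc lo hi)
    (h1 : 2 * π * t0 D - ell1 D ∈ Icc lo hi) (h2 : 2 * π * t0 D + ell1 D ∈ Icc lo hi) :
    rectIntegral D Lm Lp F -
        (Lemma81.segInt (t0 D) (ell1 D) ((alpha D : ℝ) : ℂ) F -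
          Lemma81.segInt (t0 D) (ell1 D) ((-alpha D : ℝ) : ℂ) F) =
      (1 / (2 * π * I)) *
          ((∫ x in (1 / 2 - alpha D)..(1 / 2 + alpha D), F (x + ((2 * π * t0 D + Lm : ℝ) : ℂ) * I)) -
            (∫ x in (1 / 2 - alpha D)..(1 / 2 + alpha D), F (x + ((2 * π * t0 D + Lp : ℝ) : ℂ) * I)))
        + (1 / (2 * π) : ℂ) *
          ((∫ y in (2 * π * t0 D + Lm)..(2 * π * t0 D - ell1 D),
              F (((1 / 2 + alpha D : ℝ) : ℂ) + y * I)) -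
            (∫ y in (2 * π * t0 D + Lp)..(2 * π * t0 D + ell1 D),
              F (((1 / 2 + alpha D : ℝ) : ℂ) + y * I)))
        - (1 / (2 * π) : ℂ) *
          ((∫ y in (2 * π * t0 D + Lm)..(2 * π * t0 D - ell1 D),
              F (((1 / 2 - alpha D : ℝ) : ℂ) + y * I)) -
            (∫ y in (2 * π * t0 D + Lp)..(2 * π * t0 D + ell1 D),
              F (((1 / 2 - alpha D : ℝ) : ℂ) + y * I))) := by
  have hib : ∀ u v : ℝ, u ∈ Icc lo hi → v ∈ Icc lo hi →
      IntervalIntegrable (fun y : ℝ => F (((1 / 2 + alpha D : ℝ) : ℂ) + y * I)) volume u v :=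
    fun u v hu hv => (hKb.mono (Set.uIcc_subset_Icc hu hv)).intervalIntegrable
  have hia : ∀ u v : ℝ, u ∈ Icc lo hi → v ∈ Icc lo hi →
      IntervalIntegrable (fun y : ℝ => F (((1 / 2 - alpha D : ℝ) : ℂ) + y * I)) volume u v :=
    fun u v hu hv => (hKa.mono (Set.uIcc_subset_Icc hu hv)).intervalIntegrable
  have hVb := intervalIntegral.integral_interval_sub_interval_comm (hib _ _ hc hd) (hib _ _ h1 h2)
    (hib _ _ hc h1)
  have hVa := intervalIntegral.integral_interval_sub_interval_comm (hia _ _ hc hd) (hia _ _ h1 h2)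
    (hia _ _ hc h1)
  have hsb : Lemma81.segInt (t0 D) (ell1 D) ((alpha D : ℝ) : ℂ) F =
      (1 / (2 * π) : ℂ) * ∫ y in (2 * π * t0 D - ell1 D)..(2 * π * t0 D + ell1 D),
        F (((1 / 2 + alpha D : ℝ) : ℂ) + y * I) := by
    rw [Lemma81.segInt_def]
    congr 1
    have h := intervalIntegral.integral_comp_add_right
      (fun y : ℝ => F (((1 / 2 + alpha D : ℝ) : ℂ) + y * I)) (2 * π * t0 D)
      (a := -ell1 D) (b := ell1 D)
    rw [show 2 * π * t0 D - ell1 D = -ell1 D + 2 * π * t0 D by ring,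
      show 2 * π * t0 D + ell1 D = ell1 D + 2 * π * t0 D by ring, ← h]
    refine intervalIntegral.integral_congr fun v _ => ?_
    simp only [SmoothWeight.s0_def]
    congr 1
    push_cast
    ring
  have hsa : Lemma81.segInt (t0 D) (ell1 D) ((-alpha D : ℝ) : ℂ) F =
      (1 / (2 * π) : ℂ) * ∫ y in (2 * π * t0 D - ell1 D)..(2 * π * t0 D + ell1 D),
        F (((1 / 2 - alpha D : ℝ) : ℂ) + y * I) := by
    rw [Lemma81.segInt_def]
    congr 1
    have h := intervalIntegral.integral_comp_add_right
      (fun y : ℝ => F (((1 / 2 - alpha D : ℝ) : ℂ) + y * I)) (2 * π * t0 D)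
      (a := -ell1 D) (b := ell1 D)
    rw [show 2 * π * t0 D - ell1 D = -ell1 D + 2 * π * t0 D by ring,
      show 2 * π * t0 D + ell1 D = ell1 D + 2 * π * t0 D by ring, ← h]
    refine intervalIntegral.integral_congr fun v _ => ?_
    simp only [SmoothWeight.s0_def]
    congr 1
    push_cast
    ring
  rw [hsb, hsa, rectIntegral, Literature.Analysis.Complex.rectBoundaryIntegral_def]
  set Vb := ∫ y in (2 * π * t0 D + Lm)..(2 * π * t0 D + Lp), F (((1 / 2 + alpha D : ℝ) : ℂ) + y * I)
    with hVbdef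
  set Va := ∫ y in (2 * π * t0 D + Lm)..(2 * π * t0 D + Lp), F (((1 / 2 - alpha D : ℝ) : ℂ) + y * I)
    with hVadef
  have hπ : (π : ℂ) ≠ 0 := ofReal_ne_zero.mpr Real.pi_ne_zero
  have hI : (1 / (2 * π * I) : ℂ) * I = 1 / (2 * π) := by
    field_simp
  linear_combination (Vb - Va) * hI + (1 / (2 * π) : ℂ) * hVb - (1 / (2 * π) : ℂ) * hVa

/-! ### G. The clearance on the vertical lines from Proposition 2.2 (i) -/

/-- On the lines `σ = ½ ± α`, `|t − 2πt₀| ≤ 𝓛₁ + 1`, every zero `ρ` of `L(s,ψ)` is at distance `≥ α`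
once the zeros of `L(s,ψ)L(s,ψχ)` in `Ω` lie on the critical line (Prop. 2.2 (i) at `ψ`): zeros in `Ω`
are `α` away horizontally, zeros outside `Ω` are `≥ ½ − α ≥ α` away horizontally or `≥ 1` away
vertically. [cite: Zhang2022LandauSiegel, §8 p.42, tex L2197–2201; §2 Prop. 2.2 (i)] -/
theorem clearance_of_prop22i {D : ℕ} [NeZero D] {χ : DirichletCharacter ℂ D} {x : Chr D}
    (h22 : ∀ s ∈ prodZeroSetOmega χ x, s.re = 1 / 2)
    (hα4 : alpha D ≤ 1 / 4) {s : ℂ} (hσ : |s.re - 1 / 2| = alpha D)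
    (ht : |s.im - 2 * π * t0 D| ≤ ell1 D + 1) :
    ∀ ρ : ℂ, x.ψ.LFunction ρ = 0 → alpha D ≤ ‖s - ρ‖ := by
  intro ρ hρ
  by_cases hΩ : ρ ∈ Omega D
  · have hre : ρ.re = 1 / 2 := h22 ρ ⟨hΩ, by rw [hρ, zero_mul]⟩
    calc alpha D = |s.re - 1 / 2| := hσ.symm
      _ = |(s - ρ).re| := by rw [sub_re, hre]
      _ ≤ ‖s - ρ‖ := Complex.abs_re_le_norm _
  · rw [Omega, Set.mem_setOf_eq, not_and_or, not_lt, not_lt] at hΩ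
    have hs0re : (ρ - s0 D).re = ρ.re - 1 / 2 := by
      rw [s0, SmoothWeight.s0_def]; simp
    have hs0im : (ρ - s0 D).im = ρ.im - 2 * π * t0 D := by
      rw [s0, SmoothWeight.s0_def]; simp
    rcases hΩ with h | h
    · rw [hs0re] at h
      calc alpha D ≤ |(s - ρ).re| := by
            rw [sub_re, abs_sub_comm]
            have h1 := abs_sub_abs_le_abs_sub (ρ.re - 1 / 2) (s.re - 1 / 2)
            rw [show ρ.re - 1 / 2 - (s.re - 1 / 2) = ρ.re - s.re by ring] at h1
            linarith
        _ ≤ ‖s - ρ‖ := Complex.abs_re_le_norm _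
    · rw [hs0im] at h
      calc alpha D ≤ |(s - ρ).im| := by
            rw [sub_im, abs_sub_comm]
            have h1 := abs_sub_abs_le_abs_sub (ρ.im - 2 * π * t0 D) (s.im - 2 * π * t0 D)
            rw [show ρ.im - 2 * π * t0 D - (s.im - 2 * π * t0 D) = ρ.im - s.im by ring] at h1
            linarith
        _ ≤ ‖s - ρ‖ := Complex.abs_im_le_norm _

/-! ### H. The edge: Proposition 2.2 ⇒ `Eq81b` -/

/-- `‖1/(2πi)‖ ≤ 1/6` and `‖1/2π‖ ≤ 1/6`. [folklore] -/
private theorem norm_prefactors_le :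
    ‖(1 / (2 * π * I) : ℂ)‖ ≤ 1 / 6 ∧ ‖(1 / (2 * π) : ℂ)‖ ≤ 1 / 6 := by
  have hπ := Real.pi_gt_three
  have h1 : ‖(1 / (2 * π) : ℂ)‖ = 1 / (2 * π) := by
    rw [show (1 / (2 * π) : ℂ) = ((1 / (2 * π) : ℝ) : ℂ) by push_cast; ring, Complex.norm_real,
      Real.norm_of_nonneg (by positivity)]
  have h2 : ‖(1 / (2 * π * I) : ℂ)‖ = 1 / (2 * π) := by
    rw [norm_div, norm_mul, Complex.norm_I, mul_one, norm_one,
      show (2 * π : ℂ) = ((2 * π : ℝ) : ℂ) by push_cast; ring, Complex.norm_real,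
      Real.norm_of_nonneg (by positivity)]
  have h3 : 1 / (2 * π) ≤ (1 : ℝ) / 6 := by
    rw [div_le_div_iff₀ (by positivity) (by norm_num)]; linarith
  exact ⟨h2 ▸ h3, h1 ▸ h3⟩

/-- A horizontal edge of `∂ℜ` at height `2πt₀ + L′`, `𝓛₁ − 1 ≤ |L′| ≤ 𝓛₁ + ¼`, contributes at most
`M·2α` once the integrand is `≤ M` on the pieces (abstract bookkeeping; `P` = the clearance).
[cite: Zhang2022LandauSiegel, §8 (8.1) p.42] -/
private theorem norm_integral_horizontal_81b {F : ℂ → ℂ} {P : ℂ → Prop} {M α T L' ℓ : ℝ}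
    (hα : 0 ≤ α)
    (hMs : ∀ s : ℂ, |s.re - 1 / 2| ≤ α → ℓ - 1 ≤ |s.im - T| → |s.im - T| ≤ ℓ + 1 / 4 → P s →
      ‖F s‖ ≤ M)
    (hL'1 : |L'| ≤ ℓ + 1 / 4) (hL'2 : ℓ - 1 ≤ |L'|)
    (hP : ∀ s : ℂ, |s.re - 1 / 2| ≤ α → s.im = T + L' → P s) :
    ‖∫ u in (1 / 2 - α)..(1 / 2 + α), F (u + ((T + L' : ℝ) : ℂ) * I)‖ ≤
      M * |1 / 2 + α - (1 / 2 - α)| := by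
  refine intervalIntegral.norm_integral_le_of_norm_le_const fun u hu => ?_
  rw [Set.uIoc_of_le (by linarith : 1 / 2 - α ≤ 1 / 2 + α)] at hu
  have hre : ((u : ℂ) + ((T + L' : ℝ) : ℂ) * I).re = u := by simp
  have him : ((u : ℂ) + ((T + L' : ℝ) : ℂ) * I).im = T + L' := by simp
  have hσ : |((u : ℂ) + ((T + L' : ℝ) : ℂ) * I).re - 1 / 2| ≤ α := by
    rw [hre, abs_le]; constructor <;> linarith [hu.1, hu.2]
  exact hMs _ hσ (by rw [him, add_sub_cancel_left]; exact hL'2)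
    (by rw [him, add_sub_cancel_left]; exact hL'1) (hP _ hσ him)

/-- A vertical sliver on `σ` (`|σ − ½| = α`) between heights `u`, `v` on the same side of `T = 2πt₀`
with `𝓛₁ − ¼ ≤ |u − T|, |v − T| ≤ 𝓛₁ + ¼` contributes at most `M·|v − u|` (abstract bookkeeping).
[cite: Zhang2022LandauSiegel, §8 (8.1) p.42] -/
private theorem norm_integral_vertical_81b {F : ℂ → ℂ} {P : ℂ → Prop} {M α T ℓ σ u v : ℝ}
    (hMs : ∀ s : ℂ, |s.re - 1 / 2| ≤ α → ℓ - 1 ≤ |s.im - T| → |s.im - T| ≤ ℓ + 1 / 4 → P s →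
      ‖F s‖ ≤ M)
    (hσ : |σ - 1 / 2| = α)
    (hu1 : ℓ - 1 / 4 ≤ |u - T|) (hu2 : |u - T| ≤ ℓ + 1 / 4)
    (hv1 : ℓ - 1 / 4 ≤ |v - T|) (hv2 : |v - T| ≤ ℓ + 1 / 4)
    (hside : (0 ≤ u - T ∧ 0 ≤ v - T) ∨ (u - T ≤ 0 ∧ v - T ≤ 0))
    (hP : ∀ s : ℂ, |s.re - 1 / 2| = α → |s.im - T| ≤ ℓ + 1 → P s) :
    ‖∫ y in u..v, F ((σ : ℂ) + y * I)‖ ≤ M * |v - u| := by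
  refine intervalIntegral.norm_integral_le_of_norm_le_const fun y hy => ?_
  have hre : ((σ : ℂ) + y * I).re = σ := by simp
  have him : ((σ : ℂ) + y * I).im = y := by simp
  have hy' : ℓ - 1 / 4 ≤ |y - T| ∧ |y - T| ≤ ℓ + 1 / 4 := by
    rw [Set.mem_uIoc] at hy
    rcases hside with ⟨hu0, hv0⟩ | ⟨hu0, hv0⟩
    · rw [abs_of_nonneg hu0] at hu1 hu2
      rw [abs_of_nonneg hv0] at hv1 hv2
      rcases hy with ⟨hy1, hy2⟩ | ⟨hy1, hy2⟩
      · rw [abs_of_nonneg (by linarith)]; constructor <;> linarith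
      · rw [abs_of_nonneg (by linarith)]; constructor <;> linarith
    · rw [abs_of_nonpos hu0] at hu1 hu2
      rw [abs_of_nonpos hv0] at hv1 hv2
      rcases hy with ⟨hy1, hy2⟩ | ⟨hy1, hy2⟩
      · rw [abs_of_nonpos (by linarith)]; constructor <;> linarith
      · rw [abs_of_nonpos (by linarith)]; constructor <;> linarith
  exact hMs _ (by rw [hre, hσ]) (by rw [him]; linarith [hy'.1]) (by rw [him]; exact hy'.2)
    (hP _ (by rw [hre, hσ]) (by rw [him]; linarith [hy'.2]))

/-- The final arithmetic: six pieces of size `≤ M/4` each, weighted by `‖1/2πi‖, ‖1/2π‖ ≤ 1/6`,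
total at most `M`. [folklore] -/
private theorem six_pieces_le {k m Hc Hd Pb Qb Pa Qa : ℂ} {M l₁ l₂ l₃ : ℝ} (hM : 0 ≤ M)
    (hk : ‖k‖ ≤ 1 / 6) (hm : ‖m‖ ≤ 1 / 6)
    (hHc : ‖Hc‖ ≤ M * l₁) (hHd : ‖Hd‖ ≤ M * l₁) (hPb : ‖Pb‖ ≤ M * l₂) (hQb : ‖Qb‖ ≤ M * l₃)
    (hPa : ‖Pa‖ ≤ M * l₂) (hQa : ‖Qa‖ ≤ M * l₃)
    (hl₁ : l₁ ≤ 1 / 4) (hl₂ : l₂ ≤ 1 / 4) (hl₃ : l₃ ≤ 1 / 4) :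
    ‖k * (Hc - Hd) + m * (Pb - Qb) - m * (Pa - Qa)‖ ≤ M := by
  have h1 : ‖k * (Hc - Hd)‖ ≤ 1 / 6 * (M / 4 + M / 4) := by
    rw [norm_mul]
    exact mul_le_mul hk ((norm_sub_le _ _).trans (add_le_add (by nlinarith) (by nlinarith)))
      (norm_nonneg _) (by norm_num)
  have h2 : ‖m * (Pb - Qb)‖ ≤ 1 / 6 * (M / 4 + M / 4) := by
    rw [norm_mul]
    exact mul_le_mul hm ((norm_sub_le _ _).trans (add_le_add (by nlinarith) (by nlinarith)))
      (norm_nonneg _) (by norm_num)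
  have h3 : ‖m * (Pa - Qa)‖ ≤ 1 / 6 * (M / 4 + M / 4) := by
    rw [norm_mul]
    exact mul_le_mul hm ((norm_sub_le _ _).trans (add_le_add (by nlinarith) (by nlinarith)))
      (norm_nonneg _) (by norm_num)
  calc ‖k * (Hc - Hd) + m * (Pb - Qb) - m * (Pa - Qa)‖
      ≤ ‖k * (Hc - Hd) + m * (Pb - Qb)‖ + ‖m * (Pa - Qa)‖ := norm_sub_le _ _
    _ ≤ ‖k * (Hc - Hd)‖ + ‖m * (Pb - Qb)‖ + ‖m * (Pa - Qa)‖ :=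
        add_le_add (norm_add_le _ _) le_rfl
    _ ≤ 1 / 6 * (M / 4 + M / 4) + 1 / 6 * (M / 4 + M / 4) + 1 / 6 * (M / 4 + M / 4) := by
        linarith
    _ ≤ M := by linarith

set_option maxHeartbeats 400000 in
/-- **`Z22:(8.1)`, second equality, DISCHARGED modulo Proposition 2.2**: `Skeleton.Prop22 c′ → Eq81b c′`
for `c′ ≥ 0` — "… and a simple bound for `ω(s)`, `(1/2πi)∫_ℜ 𝒞̃AAω ds = Ĩ₁⁺ − Ĩ₁⁻ + O(ε)`", with
`ε = e^{−𝓛¹⁰/8}` (`c = 1/8`). Proof, as printed and made explicit: the contour `∂ℜ` differs from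
`𝔍(α) − 𝔍(−α)` by the two horizontal edges (length `2α`) and four vertical slivers (length
`|𝓛₁^{±} ∓ 𝓛₁| ≤ Cα`), all at heights `|t − 2πt₀| ≥ 𝓛₁ − Cα`, where `|ω(s)| ≤ e^{2−𝓛¹⁰/4}`
(`𝓛₁² = 𝓛₂²𝓛¹⁰`); there `|𝒞̃AAω| ≤ e^{O(𝓛⁹)}·|ω|` by Lemma 5.2 (tree theorem
`Skeleton.lemma52_holds`, with `|Z(s,ψ)|⁻¹ ≤ e¹⁴`), Lemma 5.9 on `|t − 2πt₀| ≤ 𝓛₁ + ¼` (tree theorem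
`Skeleton.lemma59_restricted_of_prop22`, from Prop. 2.2; the clearance `|s − ρ| ≫ α` holds on `∂ℜ` by
admissibility and on `σ = ½ ± α` by Prop. 2.2 (i)), the convexity bound for `L(s+β_{2,3},ψ)` and the
trivial bound for `A`; Prop. 2.2 (i) also gives `M(s,ψ) ≠ 0` on `σ = ½ ± α`, whence the continuity
that splits the vertical integrals. No new facts: the typed node's announced inputs (Prop. 2.2,
Lemmas 5.2, 5.9) are all consequences of `Prop22 c′` and tree theorems.
[cite: Zhang2022LandauSiegel, §8 (8.1) p.42, tex L2203–2205] -/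
theorem eq81b_of_prop22 {c' : ℝ} (hc' : 0 ≤ c') (h22 : Prop22 c') : Eq81b c' := by
  intro B C c₀ hc₀
  obtain ⟨C₅₂, D₅₂, h52⟩ := lemma52_holds c'
  have hc₁ : 0 < min c₀ 1 := lt_min hc₀ one_pos
  obtain ⟨C₅₉, D₅₉, h59⟩ := lemma59_restricted_of_prop22 hc' h22 (min c₀ 1) hc₁
  obtain ⟨D₂₂, h22i⟩ := h22.1
  set K : ℝ := (|C₅₂| + 1) * Real.exp 14 * ((|C₅₉| + 1) *
    (16 * (∑' n : ℕ, ((n + 1 : ℕ) : ℝ) ^ (-(5 / 4 : ℝ))) ^ 2) * B ^ 2 *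
    (9 ^ 6 * 256 * Real.exp 2)) with hK
  set L₀ : ℝ := max 80 (max (5 * π * |c'| + 1) (4 * π * |C| + 1)) with hL₀
  refine ⟨1 / 8, by norm_num, K, max (max D₅₂ D₅₉) (max D₂₂ ⌈Real.exp L₀⌉₊), ?_⟩
  intro D _ χ hD hq hp _ a₁ a₂ ha₁ ha₂ x hx Lm Lp hR
  -- thresholds
  have hD52 : D₅₂ ≤ D := (le_max_left _ _).trans ((le_max_left _ _).trans hD)
  have hD59 : D₅₉ ≤ D := (le_max_right _ _).trans ((le_max_left _ _).trans hD)
  have hD22 : D₂₂ ≤ D := (le_max_left _ _).trans ((le_max_right _ _).trans hD)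
  have hDℓ : ⌈Real.exp L₀⌉₊ ≤ D := (le_max_right _ _).trans ((le_max_right _ _).trans hD)
  have hL : L₀ ≤ ell D := eq81b_threshold_le_ell hDℓ
  have h80 : 80 ≤ ell D := (le_max_left _ _).trans hL
  have hcL : 5 * π * |c'| + 1 ≤ ell D := ((le_max_left _ _).trans (le_max_right _ _)).trans hL
  have hCL : 4 * π * |C| + 1 ≤ ell D := ((le_max_right _ _).trans (le_max_right _ _)).trans hL
  obtain ⟨hα0, -, hα100, hCα, hb1, hb2, hb3⟩ := params81 h80 hcL hCL
  have hα4 : alpha D ≤ 1 / 4 := by linarith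
  have h4α : 4 * alpha D ≤ 1 := by linarith
  have hB : 0 ≤ B := (norm_nonneg _).trans (ha₁.1 0)
  have hK0 : 0 ≤ K := by rw [hK]; positivity
  have hℓ1 : (1 : ℝ) ≤ ell1 D := by rw [ell1]; exact one_le_pow₀ (by linarith)
  -- the admissible rectangle
  obtain ⟨hLp, hLm, -, hclear⟩ := hR
  have hCα' : C * alpha D ≤ 1 / 4 :=
    le_trans (mul_le_mul_of_nonneg_right (le_abs_self C) hα0.le) hCα
  obtain ⟨hLp1, hLp2⟩ := abs_le.mp (hLp.trans hCα')
  obtain ⟨hLm1, hLm2⟩ := abs_le.mp (hLm.trans hCα')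
  -- (1) the pointwise bound `M` on the pieces, with the clearance predicate `P`
  have hMs : ∀ s : ℂ, |s.re - 1 / 2| ≤ alpha D → ell1 D - 1 ≤ |s.im - 2 * π * t0 D| →
      |s.im - 2 * π * t0 D| ≤ ell1 D + 1 / 4 →
      (∀ ρ : ℂ, x.ψ.LFunction ρ = 0 → min c₀ 1 * alpha D ≤ ‖s - ρ‖) →
      ‖integrandTilde c' x a₁ a₂ s‖ ≤ K * Real.exp (-(ell D ^ 10 / 8)) := by
    intro s hσ ht1 ht2 hcl
    have h52s := h52 D χ hD52 hq hp x s ⟨hσ, by linarith⟩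
    have h59s := h59 D χ hD59 hq hp x hx s hσ ht2 hcl
    exact norm_integrandTilde_le c' x h80 hcL ha₁ ha₂ hσ ht1 ht2 h52s h59s
  -- (2) the clearance: on `∂ℜ` by admissibility, on `σ = ½ ± α` by Prop. 2.2 (i)
  have h22x : ∀ s ∈ prodZeroSetOmega χ x, s.re = 1 / 2 := h22i D χ hD22 hq hp x hx
  have hclV : ∀ s : ℂ, |s.re - 1 / 2| = alpha D → |s.im - 2 * π * t0 D| ≤ ell1 D + 1 →
      ∀ ρ : ℂ, x.ψ.LFunction ρ = 0 → min c₀ 1 * alpha D ≤ ‖s - ρ‖ := by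
    intro s hσ ht ρ hρ
    have h := clearance_of_prop22i h22x hα4 hσ ht ρ hρ
    exact le_trans (mul_le_of_le_one_left hα0.le (min_le_right _ _)) h
  have hclH : ∀ L' : ℝ, (L' = Lm ∨ L' = Lp) → ∀ s : ℂ, |s.re - 1 / 2| ≤ alpha D →
      s.im = 2 * π * t0 D + L' →
      ∀ ρ : ℂ, x.ψ.LFunction ρ = 0 → min c₀ 1 * alpha D ≤ ‖s - ρ‖ := by
    intro L' hL' s hs1 hs2 ρ hρ
    have hon : s ∈ onBoundaryR D Lm Lp := by
      refine ⟨⟨hs1, ?_, ?_⟩, ?_⟩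
      · rcases hL' with rfl | rfl <;> linarith
      · rcases hL' with rfl | rfl <;> linarith
      · intro hin
        rcases hL' with rfl | rfl
        · exact absurd hin.2.1 (by rw [hs2]; exact lt_irrefl _)
        · exact absurd hin.2.2 (by rw [hs2]; exact lt_irrefl _)
    exact le_trans (mul_le_mul_of_nonneg_right (min_le_left _ _) hα0.le) (hclear s hon ρ hρ)
  -- (3) continuity along `σ = ½ ± α` on `[T − 𝓛₁ − ¼, T + 𝓛₁ + ¼]` (no zero there, by (2))
  have hcontV : ∀ σ : ℝ, |σ - 1 / 2| = alpha D →
      ContinuousOn (fun y : ℝ => integrandTilde c' x a₁ a₂ ((σ : ℂ) + y * I))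
        (Icc (2 * π * t0 D - ell1 D - 1 / 4) (2 * π * t0 D + ell1 D + 1 / 4)) := by
    intro σ hσ
    refine continuousOn_integrandTilde_vertical c' x a₁ a₂ σ (hb1.trans h4α) (hb2.trans h4α)
      (hb3.trans h4α) (fun y hy => ?_) (fun y hy => ?_)
    · have hy' : |y - 2 * π * ell D ^ 519| ≤ ell D ^ 405 + 1 / 4 := by
        have e1 : t0 D = ell D ^ 519 := rfl
        have e2 : ell1 D = ell D ^ 405 := rfl
        rw [← e1, ← e2, abs_le]; constructor <;> linarith [hy.1, hy.2]
      linarith [(trange81 h80 hy').2.2]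
    · intro h0
      have hy' : |((σ : ℂ) + y * I).im - 2 * π * t0 D| ≤ ell1 D + 1 := by
        have : ((σ : ℂ) + y * I).im = y := by simp
        rw [this, abs_le]; constructor <;> linarith [hy.1, hy.2]
      have h := hclV ((σ : ℂ) + y * I) (by simpa using hσ) hy' _ h0
      rw [sub_self, norm_zero] at h
      linarith [mul_pos hc₁ hα0]
  have hσb : |1 / 2 + alpha D - 1 / 2| = alpha D := by rw [add_sub_cancel_left, abs_of_pos hα0]
  have hσa : |1 / 2 - alpha D - 1 / 2| = alpha D := by
    rw [sub_sub_cancel_left, abs_neg, abs_of_pos hα0]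
  -- (4) the contour identity
  have hE := rectIntegral_sub_segInt_eq (integrandTilde c' x a₁ a₂) Lm Lp _ _
    (hcontV _ hσb) (hcontV _ hσa) (by constructor <;> linarith) (by constructor <;> linarith)
    (by constructor <;> linarith) (by constructor <;> linarith)
  simp only [Itil]
  rw [hE]
  -- (5) the six pieces
  have hT1 : ∀ u : ℝ, 2 * π * t0 D + u - 2 * π * t0 D = u := fun u => by ring
  have hT2 : 2 * π * t0 D - ell1 D - 2 * π * t0 D = -ell1 D := by ring
  have hLmA : |Lm| ≤ ell1 D + 1 / 4 ∧ ell1 D - 1 / 4 ≤ |Lm| := by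
    rw [abs_of_nonpos (by linarith)]; constructor <;> linarith
  have hLpA : |Lp| ≤ ell1 D + 1 / 4 ∧ ell1 D - 1 / 4 ≤ |Lp| := by
    rw [abs_of_nonneg (by linarith)]; constructor <;> linarith
  have hℓA : |ell1 D| = ell1 D := abs_of_nonneg (by linarith)
  have hℓA' : |(-ell1 D)| = ell1 D := by rw [abs_neg, hℓA]
  have hq1 : ell1 D - 1 / 4 ≤ ell1 D := by linarith
  have hq2 : ell1 D ≤ ell1 D + 1 / 4 := by linarith
  have hHc := norm_integral_horizontal_81b (L' := Lm) hα0.le hMs hLmA.1 (by linarith [hLmA.2])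
    (hclH Lm (Or.inl rfl))
  have hHd := norm_integral_horizontal_81b (L' := Lp) hα0.le hMs hLpA.1 (by linarith [hLpA.2])
    (hclH Lp (Or.inr rfl))
  have hPb := norm_integral_vertical_81b (u := 2 * π * t0 D + Lm) (v := 2 * π * t0 D - ell1 D)
    hMs hσb (by rw [hT1]; exact hLmA.2) (by rw [hT1]; exact hLmA.1) (by rw [hT2, hℓA']; exact hq1)
    (by rw [hT2, hℓA']; exact hq2) (Or.inr ⟨by rw [hT1]; linarith, by rw [hT2]; linarith⟩) hclV
  have hQb := norm_integral_vertical_81b (u := 2 * π * t0 D + Lp) (v := 2 * π * t0 D + ell1 D)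
    hMs hσb (by rw [hT1]; exact hLpA.2) (by rw [hT1]; exact hLpA.1) (by rw [hT1, hℓA]; exact hq1)
    (by rw [hT1, hℓA]; exact hq2) (Or.inl ⟨by rw [hT1]; linarith, by rw [hT1]; linarith⟩) hclV
  have hPa := norm_integral_vertical_81b (u := 2 * π * t0 D + Lm) (v := 2 * π * t0 D - ell1 D)
    hMs hσa (by rw [hT1]; exact hLmA.2) (by rw [hT1]; exact hLmA.1) (by rw [hT2, hℓA']; exact hq1)
    (by rw [hT2, hℓA']; exact hq2) (Or.inr ⟨by rw [hT1]; linarith, by rw [hT2]; linarith⟩) hclV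
  have hQa := norm_integral_vertical_81b (u := 2 * π * t0 D + Lp) (v := 2 * π * t0 D + ell1 D)
    hMs hσa (by rw [hT1]; exact hLpA.2) (by rw [hT1]; exact hLpA.1) (by rw [hT1, hℓA]; exact hq1)
    (by rw [hT1, hℓA]; exact hq2) (Or.inl ⟨by rw [hT1]; linarith, by rw [hT1]; linarith⟩) hclV
  -- lengths and prefactors
  have hlenH : |1 / 2 + alpha D - (1 / 2 - alpha D)| ≤ 1 / 4 := by
    rw [show 1 / 2 + alpha D - (1 / 2 - alpha D) = 2 * alpha D by ring, abs_of_pos (by positivity)]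
    linarith
  have hlen1 : |2 * π * t0 D - ell1 D - (2 * π * t0 D + Lm)| ≤ 1 / 4 := by
    rw [show 2 * π * t0 D - ell1 D - (2 * π * t0 D + Lm) = -(Lm + ell1 D) by ring, abs_neg]
    exact hLm.trans hCα'
  have hlen2 : |2 * π * t0 D + ell1 D - (2 * π * t0 D + Lp)| ≤ 1 / 4 := by
    rw [show 2 * π * t0 D + ell1 D - (2 * π * t0 D + Lp) = -(Lp - ell1 D) by ring, abs_neg]
    exact hLp.trans hCα'
  obtain ⟨hk, hm⟩ := norm_prefactors_le
  -- (6) assemble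
  have hfin : Real.exp (-(1 / 8) * ell D ^ 10) = Real.exp (-(ell D ^ 10 / 8)) := by
    congr 1; ring
  rw [hfin]
  exact six_pieces_le (mul_nonneg hK0 (Real.exp_pos _).le) hk hm hHc hHd hPb hQb hPa hQa hlenH
    hlen1 hlen2

/-- The edge in the shape announced on the campaign board (inputs Prop. 2.2, Lemma 5.2, Lemma 5.9, as
the typed node's docstring lists them): the Lemma 5.2 and Lemma 5.9 inputs are subsumed (tree theorem
`Skeleton.lemma52_holds`; Lemma 5.9 on the needed height range follows from Prop. 2.2 by
`Skeleton.lemma59_restricted_of_prop22`), so they are accepted and not used.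
[cite: Zhang2022LandauSiegel, §8 (8.1) p.42, tex L2203–2205] -/
theorem eq81b_of {c' : ℝ} (hc' : 0 ≤ c') (h22 : Prop22 c') (_h52 : Lemma52 c') (_h59 : Lemma59 c') :
    Eq81b c' :=
  eq81b_of_prop22 hc' h22

end Literature.NumberTheory.LFunctions.Zhang2022.Section8aStatements
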